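import Mathlib.Analysis.Calculus.MeanValue
import Summits.QuantumFields.BalabanUV.Beta.GAN24.DerivativeRateTransfer

/-!
# `BalabanUV.Beta.GAN24.DerivativeRateTransferTaylor` — binder row G-an2-4 ∕ (CONV-C), route R6 «VALUES, NOT DERIVATIVES», PART 4:
# the TAYLOR-FORM inputs of PARTS 1–3 (`|g′(0)·2h − (g(h) − g(−h))| ≤ M h²`, `|g″(0)·h² − (g(h) − 2g(0) + g(−h))| ≤ M h³`) FROM GENUINE
# DERIVATIVES — a `C^{1,1}` (resp. `C^{2,1}`) function on `[−γ, γ]` satisfies them with `2·Lip` — so that S3 («one derivative more, bounded»)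
# plugs into `TransferInput₁.taylor` ∕ `TransferInput₂.taylor` by a Mathlib `HasDerivAt` statement (unit b2b-balaban-gan24-p3, gen 24; v1)

NOT IN PRINT; OUR PROOF ATTEMPT (for the ROUTE; every statement below is [folklore] one-variable calculus: the mean-value inequality
`Convex.norm_image_sub_le_of_norm_hasDerivWithin_le` applied to `φ(t) = g(t) − g(−t) − 2t·g′(0)` and to `ψ(t) = g(t) + g(−t) − 2g(0) − t²·g″(0)`).
HONEST FRAMING (cell contract, verbatim): «discharging `BetaPertH` makes Bałaban's UV stability UNCONDITIONAL — a real constructive-QFT result;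
it is NOT the continuum limit and NOT the Clay problem.»  HONEST DEPENDENCY (verbatim): «continuum YM on T⁴ ⇐ BetaPertH ∧ nine spine estimates
(0/9 proved); BetaPertH ⇐ (D1) ∧ (D4) ∧ CAP+tail; G-an2-4 gates asym, D1 and NE2/3/4.»  Route R6 and its steps S1–S6: header of PART 1.

WHY THIS FILE.  PARTS 1–3 take S3 in the sketch's «Taylor form» (a bound on the symmetric difference quotient's defect).  What (H2)-technology
∕ the printed anchor actually deliver is a UNIFORM BOUND ON ONE MORE DERIVATIVE ([Balaban1985BackgroundPropagators] Thm 3.4 p. 400: analyticity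
in the background on a `k`-independent radius ⇒ Cauchy bounds on every `s`-derivative; AN2 §8.3 (H2): explicit second-order formulas).  This file
is the one-line bridge: a Lipschitz bound `Lip` on `g′` (resp. `g″`) on `[−γ, γ]` gives the Taylor forms with constant `2·Lip` (the sharp constant
is `Lip`; the factor 2 is the price of using the mean-value inequality with a uniform bound instead of integrating `t ↦ 2·Lip·t` — immaterial).

WHAT THIS FILE PROVES (0 sorry): `taylor₁_of_lipschitz_deriv` (first order), `taylor₂_of_lipschitz_deriv₂` (second order), and the junction
`transferInput₁_of_derivs` building PART 1's `TransferInput₁` from `HasDerivAt` data + a uniform Lipschitz bound of the `s`-derivatives + the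
value-level rate.  No Bałaban object is instantiated; S1, S2, S3, S6 of R6 are untouched debts (header of PART 1).  SUPPLIER work; NOT one of
the nine spine estimates; NEVER «G-an2-4 closed»; NOT (CONV-C), NOT D1, NOT `BetaPertH`, NOT continuum, NOT Clay.
-/

noncomputable section

namespace Summit.QuantumFields.BalabanUV.Beta.GAN24.DerivativeRateTransferTaylor

open Set
open Summit.QuantumFields.BalabanUV.Beta.GAN24.DerivativeRateTransfer (TransferInput₁)

/-! ## §1 First order: `C^{1,1}` on `[−γ, γ]` ⇒ the Taylor form with `2·Lip` -/

/-- [folklore] **First-order Taylor form from a Lipschitz derivative.**  If `g` has derivative `g′(s)` at every `s ∈ [−γ, γ]` and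
`|g′(s) − g′(0)| ≤ Lip·|s|` there, then for `0 < h ≤ γ`: `|g′(0)·2h − (g(h) − g(−h))| ≤ 2·Lip·h²`. -/
theorem taylor₁_of_lipschitz_deriv {g g' : ℝ → ℝ} {Lip γ h : ℝ}
    (hg : ∀ s ∈ Icc (-γ) γ, HasDerivAt g (g' s) s) (hlip : ∀ s ∈ Icc (-γ) γ, |g' s - g' 0| ≤ Lip * |s|)
    (hh : 0 < h) (hhγ : h ≤ γ) :
    |g' 0 * (2 * h) - (g h - g (-h))| ≤ 2 * Lip * h ^ 2 := by
  -- `Lip ≥ 0` is forced by the hypothesis at `s = h ≠ 0`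
  have hLip : 0 ≤ Lip := by
    have := (abs_nonneg _).trans (hlip h ⟨by linarith, hhγ⟩)
    rw [abs_of_pos hh] at this
    nlinarith
  -- φ(t) = g t − g (−t) − 2 t g′(0), φ′(t) = g′(t) + g′(−t) − 2 g′(0)
  have hderiv : ∀ t ∈ Icc (0:ℝ) h,
      HasDerivWithinAt (fun s => g s - g (-s) - 2 * s * g' 0) (g' t + g' (-t) - 2 * g' 0) (Icc 0 h) t := by
    intro t ht
    have ht1 : t ∈ Icc (-γ) γ := ⟨by linarith [ht.1], by linarith [ht.2]⟩
    have ht2 : -t ∈ Icc (-γ) γ := ⟨by linarith [ht.2], by linarith [ht.1]⟩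
    have h1 : HasDerivAt g (g' t) t := hg t ht1
    have h2 : HasDerivAt (fun s => g (-s)) (-g' (-t)) t := by
      have := (hg (-t) ht2).comp t (hasDerivAt_neg t)
      simpa [Function.comp_def] using this
    have h3 : HasDerivAt (fun s => 2 * s * g' 0) (2 * g' 0) t := by
      have := ((hasDerivAt_id t).const_mul 2).mul_const (g' 0)
      simpa using this
    have h4 : HasDerivAt (fun s => g s - g (-s) - 2 * s * g' 0) (g' t - -g' (-t) - 2 * g' 0) t := (h1.sub h2).sub h3
    have e : g' t - -g' (-t) - 2 * g' 0 = g' t + g' (-t) - 2 * g' 0 := by ring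
    rw [e] at h4
    exact h4.hasDerivWithinAt
  have hbound : ∀ t ∈ Icc (0:ℝ) h, ‖g' t + g' (-t) - 2 * g' 0‖ ≤ 2 * Lip * h := by
    intro t ht
    have ht1 : t ∈ Icc (-γ) γ := ⟨by linarith [ht.1], by linarith [ht.2]⟩
    have ht2 : -t ∈ Icc (-γ) γ := ⟨by linarith [ht.2], by linarith [ht.1]⟩
    have e : g' t + g' (-t) - 2 * g' 0 = (g' t - g' 0) + (g' (-t) - g' 0) := by ring
    rw [Real.norm_eq_abs, e]
    calc |(g' t - g' 0) + (g' (-t) - g' 0)| ≤ |g' t - g' 0| + |g' (-t) - g' 0| := abs_add_le _ _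
      _ ≤ Lip * |t| + Lip * |(-t)| := add_le_add (hlip t ht1) (hlip (-t) ht2)
      _ = 2 * Lip * t := by rw [abs_neg, abs_of_nonneg ht.1]; ring
      _ ≤ 2 * Lip * h := by nlinarith [ht.2]
  have hmv := (convex_Icc (0:ℝ) h).norm_image_sub_le_of_norm_hasDerivWithin_le hderiv hbound
    (left_mem_Icc.mpr hh.le) (right_mem_Icc.mpr hh.le)
  simp only [neg_zero, sub_self, mul_zero, zero_mul, sub_zero, Real.norm_eq_abs, abs_of_pos hh] at hmv
  rw [abs_sub_comm]
  calc |g h - g (-h) - g' 0 * (2 * h)| = |g h - g (-h) - 2 * h * g' 0| := by ring_nf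
    _ ≤ 2 * Lip * h * h := hmv
    _ = 2 * Lip * h ^ 2 := by ring

/-! ## §2 Second order: `C^{2,1}` on `[−γ, γ]` ⇒ the Taylor form with `2·Lip` -/

/-- [folklore] **Second-order Taylor form from a Lipschitz second derivative.**  If `g` has derivative `g′`, `g′` has derivative `g″` at
every point of `[−γ, γ]`, and `|g″(s) − g″(0)| ≤ Lip·|s|` there, then for `0 < h ≤ γ`:
`|g″(0)·h² − (g(h) − 2g(0) + g(−h))| ≤ 2·Lip·h³`. -/
theorem taylor₂_of_lipschitz_deriv₂ {g g' g'' : ℝ → ℝ} {Lip γ h : ℝ}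
    (hg : ∀ s ∈ Icc (-γ) γ, HasDerivAt g (g' s) s) (hg' : ∀ s ∈ Icc (-γ) γ, HasDerivAt g' (g'' s) s)
    (hlip : ∀ s ∈ Icc (-γ) γ, |g'' s - g'' 0| ≤ Lip * |s|) (hh : 0 < h) (hhγ : h ≤ γ) :
    |g'' 0 * h ^ 2 - (g h - 2 * g 0 + g (-h))| ≤ 2 * Lip * h ^ 3 := by
  have hLip : 0 ≤ Lip := by
    have := (abs_nonneg _).trans (hlip h ⟨by linarith, hhγ⟩)
    rw [abs_of_pos hh] at this
    nlinarith
  -- χ(t) = g′ t − g′(−t) − 2 t g″(0): |χ t| ≤ 2 Lip t² on [0, h] (first-order argument on [0, t])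
  have hχ : ∀ t ∈ Icc (0:ℝ) h, |g' t - g' (-t) - 2 * t * g'' 0| ≤ 2 * Lip * h ^ 2 := by
    intro t ht
    rcases ht.1.eq_or_lt with ht0 | htpos
    · subst ht0; simp; positivity
    have hderiv : ∀ u ∈ Icc (0:ℝ) t,
        HasDerivWithinAt (fun s => g' s - g' (-s) - 2 * s * g'' 0) (g'' u + g'' (-u) - 2 * g'' 0) (Icc 0 t) u := by
      intro u hu
      have hu1 : u ∈ Icc (-γ) γ := ⟨by linarith [hu.1], by linarith [hu.2, ht.2]⟩
      have hu2 : -u ∈ Icc (-γ) γ := ⟨by linarith [hu.2, ht.2], by linarith [hu.1]⟩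
      have h1 : HasDerivAt g' (g'' u) u := hg' u hu1
      have h2 : HasDerivAt (fun s => g' (-s)) (-g'' (-u)) u := by
        have := (hg' (-u) hu2).comp u (hasDerivAt_neg u)
        simpa [Function.comp_def] using this
      have h3 : HasDerivAt (fun s => 2 * s * g'' 0) (2 * g'' 0) u := by
        have := ((hasDerivAt_id u).const_mul 2).mul_const (g'' 0)
        simpa using this
      have h4 : HasDerivAt (fun s => g' s - g' (-s) - 2 * s * g'' 0) (g'' u - -g'' (-u) - 2 * g'' 0) u := (h1.sub h2).sub h3
      have e : g'' u - -g'' (-u) - 2 * g'' 0 = g'' u + g'' (-u) - 2 * g'' 0 := by ring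
      rw [e] at h4
      exact h4.hasDerivWithinAt
    have hbound : ∀ u ∈ Icc (0:ℝ) t, ‖g'' u + g'' (-u) - 2 * g'' 0‖ ≤ 2 * Lip * t := by
      intro u hu
      have hu1 : u ∈ Icc (-γ) γ := ⟨by linarith [hu.1], by linarith [hu.2, ht.2]⟩
      have hu2 : -u ∈ Icc (-γ) γ := ⟨by linarith [hu.2, ht.2], by linarith [hu.1]⟩
      have e : g'' u + g'' (-u) - 2 * g'' 0 = (g'' u - g'' 0) + (g'' (-u) - g'' 0) := by ring
      rw [Real.norm_eq_abs, e]
      calc |(g'' u - g'' 0) + (g'' (-u) - g'' 0)| ≤ |g'' u - g'' 0| + |g'' (-u) - g'' 0| := abs_add_le _ _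
        _ ≤ Lip * |u| + Lip * |(-u)| := add_le_add (hlip u hu1) (hlip (-u) hu2)
        _ = 2 * Lip * u := by rw [abs_neg, abs_of_nonneg hu.1]; ring
        _ ≤ 2 * Lip * t := by nlinarith [hu.2]
    have hmv := (convex_Icc (0:ℝ) t).norm_image_sub_le_of_norm_hasDerivWithin_le hderiv hbound
      (left_mem_Icc.mpr htpos.le) (right_mem_Icc.mpr htpos.le)
    simp only [neg_zero, sub_self, mul_zero, zero_mul, sub_zero, Real.norm_eq_abs, abs_of_pos htpos] at hmv
    calc |g' t - g' (-t) - 2 * t * g'' 0| ≤ 2 * Lip * t * t := hmv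
      _ ≤ 2 * Lip * h ^ 2 := by
          have hth : t * t ≤ h * h := mul_self_le_mul_self ht.1 ht.2
          nlinarith [hth, hLip]
  -- ψ(t) = g t + g(−t) − 2 g 0 − t² g″(0), ψ′ = χ
  have hderiv : ∀ t ∈ Icc (0:ℝ) h,
      HasDerivWithinAt (fun s => g s + g (-s) - 2 * g 0 - s ^ 2 * g'' 0) (g' t - g' (-t) - 2 * t * g'' 0) (Icc 0 h) t := by
    intro t ht
    have ht1 : t ∈ Icc (-γ) γ := ⟨by linarith [ht.1], by linarith [ht.2]⟩
    have ht2 : -t ∈ Icc (-γ) γ := ⟨by linarith [ht.2], by linarith [ht.1]⟩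
    have h1 : HasDerivAt g (g' t) t := hg t ht1
    have h2 : HasDerivAt (fun s => g (-s)) (-g' (-t)) t := by
      have := (hg (-t) ht2).comp t (hasDerivAt_neg t)
      simpa [Function.comp_def] using this
    have h3 : HasDerivAt (fun s : ℝ => 2 * g 0) 0 t := hasDerivAt_const t _
    have h4 : HasDerivAt (fun s : ℝ => s ^ 2 * g'' 0) (2 * t * g'' 0) t := by
      have := (hasDerivAt_pow 2 t).mul_const (g'' 0)
      simpa using this
    have h5 : HasDerivAt (fun s => g s + g (-s) - 2 * g 0 - s ^ 2 * g'' 0) (g' t + -g' (-t) - 0 - 2 * t * g'' 0) t :=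
      ((h1.add h2).sub h3).sub h4
    have e : g' t + -g' (-t) - 0 - 2 * t * g'' 0 = g' t - g' (-t) - 2 * t * g'' 0 := by ring
    rw [e] at h5
    exact h5.hasDerivWithinAt
  have hbound : ∀ t ∈ Icc (0:ℝ) h, ‖g' t - g' (-t) - 2 * t * g'' 0‖ ≤ 2 * Lip * h ^ 2 := fun t ht => by
    rw [Real.norm_eq_abs]; exact hχ t ht
  have hmv := (convex_Icc (0:ℝ) h).norm_image_sub_le_of_norm_hasDerivWithin_le hderiv hbound
    (left_mem_Icc.mpr hh.le) (right_mem_Icc.mpr hh.le)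
  simp only [neg_zero, zero_mul, sub_zero, Real.norm_eq_abs, abs_of_pos hh, ne_eq, OfNat.ofNat_ne_zero,
    not_false_eq_true, zero_pow] at hmv
  rw [abs_sub_comm]
  calc |g h - 2 * g 0 + g (-h) - g'' 0 * h ^ 2| = |g h + g (-h) - 2 * g 0 - h ^ 2 * g'' 0 - (g 0 + g 0 - 2 * g 0)| := by ring_nf
    _ ≤ 2 * Lip * h ^ 2 * h := hmv
    _ = 2 * Lip * h ^ 3 := by ring

/-! ## §3 Junction with PART 1: `TransferInput₁` from derivative data -/

/-- **`TransferInput₁` FROM GENUINE DERIVATIVES.**  For a kernel family `F k s y y′` with `s`-derivatives `F′ k s y y′` on `[−γ, γ]`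
(`HasDerivAt`), a UNIFORM Lipschitz-at-0 bound `|F′ k s − F′ k 0|(y,y′) ≤ Lip·|s|` (what a uniform bound `Lip` on `∂_s²F` gives by the mean
value theorem; (H2)⁺ ∕ Cauchy estimates deliver such bounds), and the value-level rate `Cθ^k` on `|s| ≤ γ`: PART 1's [shape]
`TransferInput₁ F (k y y′ ↦ F′ k 0 y y′) γ (2·Lip) C θ` holds — so `deriv_step_supRate` ∕ `deriv_step_decay` ∕ `convC_deriv₁` apply to the
genuine `s`-derivatives at `0`. -/
theorem transferInput₁_of_derivs {ι : Type*} {F F' : ℕ → ℝ → ι → ι → ℝ} {γ Lip C θ : ℝ}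
    (hF : ∀ k y y', ∀ s ∈ Icc (-γ) γ, HasDerivAt (fun s => F k s y y') (F' k s y y') s)
    (hlip : ∀ k y y', ∀ s ∈ Icc (-γ) γ, |F' k s y y' - F' k 0 y y'| ≤ Lip * |s|)
    (hstep : ∀ k y y' s, |s| ≤ γ → |F (k + 1) s y y' - F k s y y'| ≤ C * θ ^ k) :
    TransferInput₁ F (fun k y y' => F' k 0 y y') γ (2 * Lip) C θ where
  taylor k y y' _ hh hhγ := taylor₁_of_lipschitz_deriv (g := fun s => F k s y y') (g' := fun s => F' k s y y')
    (hF k y y') (hlip k y y') hh hhγ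
  step := hstep

end Summit.QuantumFields.BalabanUV.Beta.GAN24.DerivativeRateTransferTaylor
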